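import Literature.NumberTheory.EllipticCurves.SharpFlatPAdicLFunctionCoeffField
import Literature.NumberTheory.EllipticCurves.PAdicPowerSeriesZeros
import Mathlib.NumberTheory.Padics.Complex
import Mathlib.Analysis.Normed.Group.Ultra
import HarnessLib

/-!
# Sketch — stub-ideation k1 (gen 3) for `stub_cmLambdaLower` (S2 = RSL_g, stmt-BirchSwinnertonDyer-22608)
# TECHNIQUE weaken / strengthen, scoped (critic rev 3 §7 Q11) to N2 = KZ_g(i) kernel half:
# «which valuation data of the explicit reciprocity law does S2 actually consume?»

Seat `planner-sidea-stub_cmLambdaLower-1-g3-0`.  HONEST FRAMING: three helper SIGNATURES (sorried: H0, H7, H8) and six PROVED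
lemmas (H5, H5≤, H5=, the coefficient bridge, H6, H7′); pure `p`-adic analysis of power series with bounded coefficients on the open unit disc of
`ℂ_p` plus one evaluation lemma for `IsCongrModOmegaO`; nothing about any Selmer group; BSD is not proved by any of this.

* §A  DOMINANT TERM ON THE OUTER ANNULUS (H5, proved) and the RATIO-MONOTONICITY CRITERIA (H5≤ proved from H5, H5= proved
      from H5≤): the `normλ` index (`= λ` after removing the content) of a bounded series is read off the GROWTH of
      `‖F(z)‖` as `‖z‖ ↑ 1`, and `λ_G ≤ λ_F` iff the ratio `‖F‖/‖G‖` does not DEcrease between two radii close to `1`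
      — for infinitely many such pairs.  No units, no congruences, no constants, no `μ`.
* §B  the same in the route's currency `IwasawaAlgebraO S = 𝒪⟦T⟧` with the stub's `normλ` binders (H6, from H5≤).
* §C  EVALUATING AN `ω_n`-CONGRUENCE AT A ROOT OF `ω_n` (H7): `IsCongrModOmegaO S n θ (w·L)` gives
      `θ(ζ−1) = w(ζ−1)·L(ζ−1)` for `ζ^{pⁿ} = 1` — so at a primitive character of an EVEN level both the plus-Coleman
      value (tree `SignedColemanImage.exists_plusValue_pairingSum`: `ω_{2m} ∣ P_{2m} − (−1)^m ω⁻_{2m} Col⁺(z)`) and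
      Pollack's `Lm` (`IsPollackPairK`: `θ_{2m}^ι ≡ (−1)^{m+1} ω⁻_{2m} Lm`) are quotients by the SAME non-zero
      `ω⁻_{2m}(ζ−1)`, which cancels in the ratio of §A.
-/

set_option autoImplicit false
set_option linter.dupNamespace false
set_option maxHeartbeats 800000

noncomputable section

open scoped Classical

namespace Summit.BirchSwinnertonDyer.BirchSwinnertonDyer.Cruxes.ResidualThetaCountLowerPureAtTwo.StubIdeasK1G3

open Literature.NumberTheory.EllipticCurves Polynomial

variable {p : ℕ} [Fact p.Prime]

/-! ### §A. Bounded coefficient sequences on the open unit disc of `ℂ_p` -/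

section Annulus

/-- `normλ`-INDEX of a coefficient sequence `a : ℕ → ℂ_p`: `d` is the FIRST index at which the maximal norm is
attained (the binders of `d` in S2 / (R≥)ᵖ for `Lm`, read in `ℂ_p`).  For `a = ` the coefficients of `F ∈ 𝒪⟦T⟧ ∖ 0`
this is the Weierstrass degree of `F/content(F)`, i.e. `λ(F)`. -/
structure IsNormLambdaIndex (a : ℕ → ℂ_[p]) (d : ℕ) : Prop where
  /-- the `d`-th coefficient has maximal norm -/
  le : ∀ k, ‖a k‖ ≤ ‖a d‖
  /-- and is the FIRST one to attain it -/
  lt : ∀ k < d, ‖a k‖ < ‖a d‖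
  /-- non-degenerate (automatic for the coefficient sequence of `F ≠ 0`, `isNormLambdaIndex_coeff`) -/
  ne : a d ≠ 0

/-- **H5 (PROVED). Dominant term on the outer annulus.**  If `d` is the `normλ`-index of the bounded sequence
`a`, then for `‖z‖ < 1` close enough to `1` the value `∑ a_k z^k` has norm EXACTLY `‖a_d‖·‖z‖^d`: every other term is
strictly smaller (`k > d`: `‖a_k‖ ≤ ‖a_d‖`, `‖z‖^k ≤ ‖z‖^{d+1}`; `k < d`: finitely many, `‖a_k‖ < ‖a_d‖` and
`‖z‖^{d-k} → 1`), and `ℂ_p` is ultrametric (`IsUltrametricDist.norm_tsum_le_of_forall_le_of_nonneg`,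
`IsUltrametricDist.norm_add_eq_max_of_norm_ne_norm`).  Equivalently (Weierstrass): `v(F(z)) = v(content) + λ·v(z)`
for `v(z)` below the valuations of the zeros of `F`.  Size S/M.
[cite: Washington1997, §7.1 Prop. 7.2–Thm. 7.3 and §7.2 (values `f(ζ−1)`)] [cite: LangCyclotomic1990, Ch. 5 §2 Thm. 2.2] -/
theorem norm_tsum_eq_of_isNormLambdaIndex {a : ℕ → ℂ_[p]} {d : ℕ} (ha : IsNormLambdaIndex a d) :
    ∃ r : ℝ, r < 1 ∧ ∀ z : ℂ_[p], r < ‖z‖ → ‖z‖ < 1 → ‖∑' k, a k * z ^ k‖ = ‖a d‖ * ‖z‖ ^ d := by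
  obtain ⟨hle, hlt, hd⟩ := ha
  set A : ℝ := ‖a d‖ with hA_def
  have hA : 0 < A := norm_pos_iff.mpr hd
  -- the lower coefficients are uniformly smaller: `‖a k‖ ≤ ρ·A` for `k < d`, some `0 ≤ ρ < 1`
  obtain ⟨ρ, hρ0, hρ1, hρ⟩ : ∃ ρ : ℝ, 0 ≤ ρ ∧ ρ < 1 ∧ ∀ k < d, ‖a k‖ ≤ ρ * A := by
    by_cases hd0 : d = 0
    · exact ⟨0, le_rfl, one_pos, fun k hk ↦ absurd hk (by omega)⟩
    · have hne : (Finset.range d).Nonempty := Finset.nonempty_range_iff.mpr hd0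
      obtain ⟨k₀, hk₀, hmax⟩ := Finset.exists_max_image (Finset.range d) (fun k ↦ ‖a k‖) hne
      refine ⟨‖a k₀‖ / A, div_nonneg (norm_nonneg _) hA.le, ?_, fun k hk ↦ ?_⟩
      · rw [div_lt_one hA]; exact hlt k₀ (Finset.mem_range.mp hk₀)
      · rw [div_mul_cancel₀ _ hA.ne']; exact hmax k (Finset.mem_range.mpr hk)
  -- radii close to `1`: `ρ < ‖z‖^d`
  have hev : ∀ᶠ t : ℝ in nhds 1, ρ < t ^ d :=
    ((continuous_pow d).tendsto (1 : ℝ)).eventually_const_lt (by rw [one_pow]; exact hρ1)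
  obtain ⟨ε, hε, hball⟩ := Metric.eventually_nhds_iff.mp hev
  refine ⟨max (1 - ε) 0, max_lt (by linarith) one_pos, fun z hrz hz1 ↦ ?_⟩
  have hrz' : 1 - ε < ‖z‖ := lt_of_le_of_lt (le_max_left _ _) hrz
  have hz0' : 0 < ‖z‖ := lt_of_le_of_lt (le_max_right _ _) hrz
  have hzd : ρ < ‖z‖ ^ d := hball (by rw [Real.dist_eq, abs_sub_comm, abs_of_pos (by linarith)]; linarith)
  have hz0 : 0 ≤ ‖z‖ := norm_nonneg _
  -- summability (domination by the geometric series `A ‖z‖^k`)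
  set f : ℕ → ℂ_[p] := fun k ↦ a k * z ^ k with hf_def
  have hs : Summable f := by
    refine Summable.of_norm_bounded (g := fun k ↦ A * ‖z‖ ^ k)
      ((summable_geometric_of_lt_one hz0 hz1).mul_left A) fun k ↦ ?_
    rw [hf_def, norm_mul, norm_pow]
    exact mul_le_mul_of_nonneg_right (hle k) (pow_nonneg hz0 _)
  -- split off the dominant term
  have hsplit : ∑' k, f k = f d + ∑' k, (if k = d then 0 else f k) := hs.tsum_eq_add_tsum_ite d
  -- the remainder is uniformly SMALLER than the dominant term
  set C : ℝ := max (A * ‖z‖ ^ (d + 1)) (ρ * A) with hC_def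
  have hC0 : 0 ≤ C := le_max_of_le_right (mul_nonneg hρ0 hA.le)
  have hdom : ‖f d‖ = A * ‖z‖ ^ d := by rw [hf_def, norm_mul, norm_pow]
  have hClt : C < A * ‖z‖ ^ d := by
    refine max_lt ?_ ?_
    · rw [pow_succ, ← mul_assoc]
      exact mul_lt_of_lt_one_right (mul_pos hA (pow_pos hz0' _)) hz1
    · calc ρ * A < ‖z‖ ^ d * A := mul_lt_mul_of_pos_right hzd hA
        _ = A * ‖z‖ ^ d := mul_comm _ _
  have hrem : ‖∑' k, (if k = d then 0 else f k)‖ ≤ C := by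
    refine IsUltrametricDist.norm_tsum_le_of_forall_le_of_nonneg hC0 fun k ↦ ?_
    by_cases hkd : k = d
    · rw [if_pos hkd, norm_zero]; exact hC0
    · rw [if_neg hkd, hf_def, norm_mul, norm_pow]
      rcases lt_or_gt_of_ne hkd with hk | hk
      · -- `k < d`: `‖a k‖ ‖z‖^k ≤ ‖a k‖ ≤ ρ A`
        calc ‖a k‖ * ‖z‖ ^ k ≤ ‖a k‖ * 1 :=
              mul_le_mul_of_nonneg_left (pow_le_one₀ hz0 hz1.le) (norm_nonneg _)
          _ ≤ ρ * A := by rw [mul_one]; exact hρ k hk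
          _ ≤ C := le_max_right _ _
      · -- `k > d`: `‖a k‖ ‖z‖^k ≤ A ‖z‖^(d+1)`
        calc ‖a k‖ * ‖z‖ ^ k ≤ A * ‖z‖ ^ (d + 1) :=
              mul_le_mul (hle k) (pow_le_pow_of_le_one hz0 hz1.le (by omega)) (pow_nonneg hz0 _) hA.le
          _ ≤ C := le_max_left _ _
  have hne : ‖f d‖ ≠ ‖∑' k, (if k = d then 0 else f k)‖ := by
    rw [hdom]; exact (ne_of_gt (hrem.trans_lt hClt))
  change ‖∑' k, f k‖ = A * ‖z‖ ^ d
  rw [hsplit, IsUltrametricDist.norm_add_eq_max_of_norm_ne_norm hne, max_eq_left, hdom]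
  rw [hdom]; exact (hrem.trans_lt hClt).le

/-- **H5≤ (PROVED from H5). Ratio-monotonicity criterion — the weakest sufficient (and necessary) form of
«`λ_G ≤ λ_F`».**  If for radii arbitrarily close to `1` there are two points `‖x‖ < ‖y‖ < 1` at which the ratio
`‖F‖/‖G‖` does not decrease from `x` to `y` (cross-multiplied, so no division and no non-vanishing is asked), then the
`normλ`-index of `G` is at most that of `F`.  Per-point scalars of norm `1`, a common constant of ANY norm, and the
`μ`-invariants are invisible to the hypothesis; only the pair of radii matters. -/
theorem isNormLambdaIndex_le_of_ratio_le {a b : ℕ → ℂ_[p]} {dF dG : ℕ}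
    (ha : IsNormLambdaIndex a dF) (hb : IsNormLambdaIndex b dG)
    (h : ∀ r : ℝ, r < 1 → ∃ x y : ℂ_[p], r < ‖x‖ ∧ ‖x‖ < ‖y‖ ∧ ‖y‖ < 1 ∧
      ‖∑' k, a k * x ^ k‖ * ‖∑' k, b k * y ^ k‖ ≤ ‖∑' k, a k * y ^ k‖ * ‖∑' k, b k * x ^ k‖) :
    dG ≤ dF := by
  obtain ⟨rF, hrF1, hF⟩ := norm_tsum_eq_of_isNormLambdaIndex ha
  obtain ⟨rG, hrG1, hG⟩ := norm_tsum_eq_of_isNormLambdaIndex hb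
  obtain ⟨x, y, hrx, hxy, hy1, hle⟩ := h (max (max rF rG) 0) (max_lt (max_lt hrF1 hrG1) one_pos)
  have hx0 : 0 < ‖x‖ := lt_of_le_of_lt (le_max_right _ _) hrx
  have hy0 : 0 < ‖y‖ := hx0.trans hxy
  have hx1 : ‖x‖ < 1 := hxy.trans hy1
  have hrFx : rF < ‖x‖ := lt_of_le_of_lt ((le_max_left _ _).trans (le_max_left _ _)) hrx
  have hrGx : rG < ‖x‖ := lt_of_le_of_lt ((le_max_right _ _).trans (le_max_left _ _)) hrx
  rw [hF x hrFx hx1, hF y (hrFx.trans hxy) hy1, hG x hrGx hx1, hG y (hrGx.trans hxy) hy1] at hle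
  have haF : 0 < ‖a dF‖ := norm_pos_iff.mpr ha.ne
  have hbG : 0 < ‖b dG‖ := norm_pos_iff.mpr hb.ne
  -- `‖x‖^dF ‖y‖^dG ≤ ‖y‖^dF ‖x‖^dG`
  have key : ‖x‖ ^ dF * ‖y‖ ^ dG ≤ ‖y‖ ^ dF * ‖x‖ ^ dG := by
    have e1 : ‖a dF‖ * ‖x‖ ^ dF * (‖b dG‖ * ‖y‖ ^ dG) = (‖a dF‖ * ‖b dG‖) * (‖x‖ ^ dF * ‖y‖ ^ dG) := by ring
    have e2 : ‖a dF‖ * ‖y‖ ^ dF * (‖b dG‖ * ‖x‖ ^ dG) = (‖a dF‖ * ‖b dG‖) * (‖y‖ ^ dF * ‖x‖ ^ dG) := by ring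
    rw [e1, e2] at hle
    exact le_of_mul_le_mul_left hle (mul_pos haF hbG)
  by_contra hlt
  push Not at hlt
  -- write `dG = dF + e` with `e ≥ 1`; then `‖y‖^e ≤ ‖x‖^e`, contradicting `‖x‖ < ‖y‖`
  obtain ⟨e, rfl⟩ := Nat.exists_eq_add_of_lt hlt
  have hxy' : ‖x‖ ^ (e + 1) < ‖y‖ ^ (e + 1) := pow_lt_pow_left₀ hxy (norm_nonneg _) (Nat.succ_ne_zero e)
  have key' : (‖x‖ ^ dF * ‖y‖ ^ dF) * ‖y‖ ^ (e + 1) ≤ (‖x‖ ^ dF * ‖y‖ ^ dF) * ‖x‖ ^ (e + 1) := by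
    have e1 : ‖x‖ ^ dF * ‖y‖ ^ (dF + e + 1) = (‖x‖ ^ dF * ‖y‖ ^ dF) * ‖y‖ ^ (e + 1) := by ring
    have e2 : ‖y‖ ^ dF * ‖x‖ ^ (dF + e + 1) = (‖x‖ ^ dF * ‖y‖ ^ dF) * ‖x‖ ^ (e + 1) := by ring
    rw [← e1, ← e2]; exact key
  have hpos : 0 < ‖x‖ ^ dF * ‖y‖ ^ dF := mul_pos (pow_pos hx0 _) (pow_pos hy0 _)
  exact absurd (le_of_mul_le_mul_left key' hpos) (not_le.mpr hxy')

/-- **H5= (PROVED from H5≤). Ratio-constancy gives EQUAL `normλ`-indices** (the equality road F-eq / RSCE: if the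
per-level discrepancy between the Coleman side and the Pollack side is eventually CONSTANT in norm, `λ` agrees). -/
theorem isNormLambdaIndex_eq_of_ratio_eq {a b : ℕ → ℂ_[p]} {dF dG : ℕ}
    (ha : IsNormLambdaIndex a dF) (hb : IsNormLambdaIndex b dG)
    (h : ∀ r : ℝ, r < 1 → ∃ x y : ℂ_[p], r < ‖x‖ ∧ ‖x‖ < ‖y‖ ∧ ‖y‖ < 1 ∧
      ‖∑' k, a k * x ^ k‖ * ‖∑' k, b k * y ^ k‖ = ‖∑' k, a k * y ^ k‖ * ‖∑' k, b k * x ^ k‖) :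
    dF = dG := by
  refine le_antisymm (isNormLambdaIndex_le_of_ratio_le hb ha fun r hr ↦ ?_)
    (isNormLambdaIndex_le_of_ratio_le ha hb fun r hr ↦ ?_)
  · obtain ⟨x, y, hrx, hxy, hy1, heq⟩ := h r hr
    exact ⟨x, y, hrx, hxy, hy1, by rw [mul_comm, ← heq, mul_comm]⟩
  · obtain ⟨x, y, hrx, hxy, hy1, heq⟩ := h r hr
    exact ⟨x, y, hrx, hxy, hy1, heq.le⟩

end Annulus

/-! ### §B. The route's currency: `F, G ∈ 𝒪⟦T⟧ = IwasawaAlgebraO S`, values at `p`-power roots of unity -/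

section IwasawaO

variable (S : Set (PadicAlgCl p))

/-- The coefficient embedding `𝒪 = padicCoeffIntegers S ⊆ ℚ̄_p → ℂ_p` (the `𝒪`-sibling of the tree's
`ιZ = (algebraMap ℚ_p ℂ_p) ∘ (algebraMap ℤ_p ℚ_p)` of `PAdicPowerSeriesZeros` / `CoreChi`). -/
abbrev coeffToCp : padicCoeffIntegers S →+* ℂ_[p] :=
  (algebraMap (PadicAlgCl p) ℂ_[p]).comp (padicCoeffIntegers S).subtype

/-- `‖ι(c)‖_{ℂ_p} = ‖c‖` for `c ∈ 𝒪` (`PadicComplex.norm_extends`). -/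
theorem norm_coeffToCp (c : padicCoeffIntegers S) : ‖coeffToCp S c‖ = ‖c‖ := by
  have h := PadicComplex.norm_extends (p := p) (c : PadicAlgCl p)
  exact h

/-- The stub's `normλ` binders for `F ∈ 𝒪⟦T⟧ ∖ 0` at `d` ARE `IsNormLambdaIndex` of the `ℂ_p`-coefficient sequence. -/
theorem isNormLambdaIndex_coeff {F : IwasawaAlgebraO S} {d : ℕ} (hF : F ≠ 0)
    (hle : ∀ k, ‖PowerSeries.coeff k F‖ ≤ ‖PowerSeries.coeff d F‖)
    (hlt : ∀ k < d, ‖PowerSeries.coeff k F‖ < ‖PowerSeries.coeff d F‖) :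
    IsNormLambdaIndex (fun k ↦ coeffToCp S (PowerSeries.coeff k F)) d := by
  refine ⟨fun k ↦ ?_, fun k hk ↦ ?_, ?_⟩
  · simpa only [norm_coeffToCp] using hle k
  · simpa only [norm_coeffToCp] using hlt k hk
  · -- if `coeff d F = 0` then all coefficients vanish (`hle`), contradicting `F ≠ 0`
    intro h0
    have h0' : coeffToCp S (PowerSeries.coeff d F) = 0 := h0
    have hd0 : PowerSeries.coeff d F = 0 := by
      have : ‖coeffToCp S (PowerSeries.coeff d F)‖ = 0 := by rw [h0', norm_zero]
      rw [norm_coeffToCp, norm_eq_zero] at this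
      exact this
    apply hF
    ext k
    have hk := hle k
    rw [hd0, norm_zero] at hk
    rw [map_zero]
    exact norm_le_zero_iff.mp hk

/-- **H6 (PROVED from H5≤). The S2 socket in valuation form.**  `G = Lm` with its `normλ`-index `dG = d` (the stub's
binders), `F = Col⁺_g(loc₂ z)` with index `dF`; if at pairs of points `ζ − 1`, `ζ' − 1` (`ζ, ζ'` `p`-power roots of
unity of increasing orders, `‖ζ−1‖ < ‖ζ'−1‖`, radii `→ 1`) the cross-ratio inequality
`‖F(ζ−1)‖·‖G(ζ'−1)‖ ≤ ‖F(ζ'−1)‖·‖G(ζ−1)‖` holds for infinitely many such pairs, then `d ≤ dF = λ(F)`.  This is ALL the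
analytic input the λ-inequality S2 consumes from the explicit reciprocity law (the values enter only through norms of
ratios at two levels per window). -/
theorem normLambda_le_of_value_ratio_le {F G : IwasawaAlgebraO S} {dF dG : ℕ} (hF : F ≠ 0) (hG : G ≠ 0)
    (hFle : ∀ k, ‖PowerSeries.coeff k F‖ ≤ ‖PowerSeries.coeff dF F‖)
    (hFlt : ∀ k < dF, ‖PowerSeries.coeff k F‖ < ‖PowerSeries.coeff dF F‖)
    (hGle : ∀ k, ‖PowerSeries.coeff k G‖ ≤ ‖PowerSeries.coeff dG G‖)
    (hGlt : ∀ k < dG, ‖PowerSeries.coeff k G‖ < ‖PowerSeries.coeff dG G‖)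
    (h : ∀ r : ℝ, r < 1 → ∃ ζ ζ' : ℂ_[p], (∃ n, ζ ^ p ^ n = 1) ∧ (∃ n, ζ' ^ p ^ n = 1) ∧
      r < ‖ζ - 1‖ ∧ ‖ζ - 1‖ < ‖ζ' - 1‖ ∧ ‖ζ' - 1‖ < 1 ∧
      ‖∑' k, coeffToCp S (PowerSeries.coeff k F) * (ζ - 1) ^ k‖ *
          ‖∑' k, coeffToCp S (PowerSeries.coeff k G) * (ζ' - 1) ^ k‖ ≤
        ‖∑' k, coeffToCp S (PowerSeries.coeff k F) * (ζ' - 1) ^ k‖ *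
          ‖∑' k, coeffToCp S (PowerSeries.coeff k G) * (ζ - 1) ^ k‖) :
    dG ≤ dF := by
  refine isNormLambdaIndex_le_of_ratio_le (isNormLambdaIndex_coeff S hF hFle hFlt)
    (isNormLambdaIndex_coeff S hG hGle hGlt) fun r hr ↦ ?_
  obtain ⟨ζ, ζ', -, -, hrx, hxy, hy1, hle⟩ := h r hr
  exact ⟨ζ - 1, ζ' - 1, hrx, hxy, hy1, hle⟩

/-- **H0 (signature). The radii**: a primitive `p^{n+1}`-th root of unity `ζ ∈ ℂ_p` has
`‖ζ − 1‖ = p^{-1/(pⁿ(p−1))}` — so along the `2`-power tower the radii `‖ζ_{2^n} − 1‖ = 2^{-2^{1-n}}` INCREASE to `1`,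
which is what makes «one primitive character per level, two levels per window» an admissible choice in H6.  Size S
(`(ζ−1)^{φ(p^{n+1})} ~ p` up to a unit, from `Φ_{p^{n+1}}(1) = p`; nearest tree decl
`Literature.NumberTheory.PAdicHodge.CyclotomicTower` l.117, `RootsOfUnityUltrametric.norm_natCast_le_norm_sub_one_of_pow_eq_one`).
[cite: Washington1997, Lemma 7.11 / proof of Thm. 7.14 (`v_p(ζ_{p^n} − 1) = 1/φ(p^n)`)] -/
theorem norm_primitiveRoot_sub_one {ζ : ℂ_[p]} {n : ℕ} (hζ : IsPrimitiveRoot ζ (p ^ (n + 1))) :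
    ‖ζ - 1‖ = (p : ℝ) ^ (-(1 / ((p : ℝ) ^ n * ((p : ℝ) - 1)))) := by
  sorry

end IwasawaO

/-! ### §C. Evaluating an `ω_n`-congruence at a root of `ω_n` -/

section Congr

variable (S : Set (PadicAlgCl p))

/-- **H7 (signature). `IsCongrModOmegaO` evaluates.**  If `p^m (θ − w·L) = ω_n·q` in `ℚ̄_p⟦T⟧` (`L, q ∈ 𝒪⟦T⟧`,
`w` a polynomial — in the route `w = (−1)^{n/2+1} ω⁻_n`) and `ζ^{pⁿ} = 1`, then
`θ(ζ−1) = w(ζ−1) · L(ζ−1)` in `ℂ_p` (`ω_n(ζ−1) = 0`, evaluation is multiplicative on bounded series: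
`tsum_map_coeff_mul_mul_pow`, `hasSum_map_coeff_coe_mul_pow`; `p^m ≠ 0`).  The `𝒪`-sibling of the tree's
`tsum_coeff_eq_eval₂_of_omega_dvd_sub` (`CongrModOmegaOfValuesProofs`).  Applied twice at a primitive character of an
EVEN level `n = 2m` — to `SignedColemanImage.exists_plusValue_pairingSum` (`P_{2m} ≡ (−1)^m ω⁻_{2m} Col⁺(z)`) and to
`IsPollackPairK` (`θ_{2m}^ι ≡ (−1)^{m+1} ω⁻_{2m} Lm`) — it shows `Col⁺(z)(ζ−1)/Lm(ζ−1) = −P_{2m}(z)(ζ−1)/θ_{2m}^ι(ζ−1)`: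
the half-logarithm `ω⁻_{2m}(ζ−1) ≠ 0` CANCELS, so H6's hypothesis is a statement about `‖χ(P_{2m,d_{2m}}(loc₂ z))‖`
and `‖χ(θ_{2m}(g)^ι)‖` only.  Size S. [cite: Pollack2003, Prop. 6.18 (values at `ζ − 1` of congruences mod `ω_n`)] -/
theorem eval_eq_of_isCongrModOmegaO {n : ℕ} {θ w : (PadicAlgCl p)[X]} {L : IwasawaAlgebraO S}
    (h : IsCongrModOmegaO S n θ ((w : PowerSeries (PadicAlgCl p)) * iwasawaOToPowerSeries S L))
    {ζ : ℂ_[p]} (hζ : ζ ^ p ^ n = 1) :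
    θ.eval₂ (algebraMap (PadicAlgCl p) ℂ_[p]) (ζ - 1) =
      w.eval₂ (algebraMap (PadicAlgCl p) ℂ_[p]) (ζ - 1) *
        ∑' k, coeffToCp S (PowerSeries.coeff k L) * (ζ - 1) ^ k := by
  sorry

/-- **H7′ (PROVED from H7). Norm form** — the only form §A consumes. -/
theorem norm_eval_eq_of_isCongrModOmegaO {n : ℕ} {θ w : (PadicAlgCl p)[X]} {L : IwasawaAlgebraO S}
    (h : IsCongrModOmegaO S n θ ((w : PowerSeries (PadicAlgCl p)) * iwasawaOToPowerSeries S L))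
    {ζ : ℂ_[p]} (hζ : ζ ^ p ^ n = 1) :
    ‖θ.eval₂ (algebraMap (PadicAlgCl p) ℂ_[p]) (ζ - 1)‖ =
      ‖w.eval₂ (algebraMap (PadicAlgCl p) ℂ_[p]) (ζ - 1)‖ *
        ‖∑' k, coeffToCp S (PowerSeries.coeff k L) * (ζ - 1) ^ k‖ := by
  rw [eval_eq_of_isCongrModOmegaO S h hζ, norm_mul]

end Congr

/-! ### §D. The Gauss-sum valuation (the one per-level «unit bookkeeping» fact that is convention-free) -/

section Gauss

/-- **H8 (signature). `2`-power Gauss sums have valuation half the conductor exponent, for EVERY choice of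
conventions.**  For `χ` a primitive Dirichlet character of conductor `2^N` (`N ≥ 2`) with values in `ℂ_2` and of
`2`-power order, and `ζ` a primitive `2^N`-th root of unity, `‖∑_a χ(a) ζ^a‖² = ‖2‖^N`: indeed `τ(χ)τ(χ̄) = χ(−1)·2^N`
and `τ(χ̄)` is a GALOIS CONJUGATE of `τ(χ)` inside `ℚ(μ_{2^∞})`, which has a single prime above `2`, so both have the
same norm.  (For odd `p` and `χ` of `p`-power order the same argument gives `‖τ(χ)‖² = ‖p‖^N`.)  This is the factor by
which `χ(θ_n)` (Birch: `τ(χ̄)·L(g,χ,1)/Ω`) and the log-character-sum of the Honda plus points differ from the bare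
`L`-value; in the valuation road it is needed only as a NORM, never as an identity of algebraic numbers.  Size S/M.
[cite: Washington1997, Lemma 4.8 (`|τ(χ)|² = f_χ`) and §6.1] [cite: Kobayashi2003, Prop. 8.26 (resolvents `± p^k τ(χ)`)] -/
theorem norm_gaussSum_sq_two_pow {N : ℕ} (hN : 2 ≤ N) (χ : DirichletCharacter ℂ_[2] (2 ^ N))
    (hχ : χ.IsPrimitive) (hord : ∃ j, orderOf χ = 2 ^ j) {ζ : ℂ_[2]} (hζ : IsPrimitiveRoot ζ (2 ^ N)) :
    ‖∑ a : ZMod (2 ^ N), χ a * ζ ^ (a.val)‖ ^ 2 = ‖(2 : ℂ_[2])‖ ^ N := by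
  sorry

end Gauss

end Summit.BirchSwinnertonDyer.BirchSwinnertonDyer.Cruxes.ResidualThetaCountLowerPureAtTwo.StubIdeasK1G3

end
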